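/-
Copyright: the b2b-balaban T⁴-continuum CRUX team, row NE7b OWNER lineage `t4-ne7b-p1` (gen 124). Project licence.
-/
import Summits.QuantumFields.BalabanUV.T4Continuum.Spine.NE7b.SupZdCovarianceBounded
import Summits.QuantumFields.BalabanUV.T4Continuum.Spine.NE7b.SupZdCoarseInverseOperator

/-!
# THE INFINITE-VOLUME FLUCTUATION COVARIANCE IS A BOUNDED OPERATOR ON `ℓ^∞(ℤ^d)`: for `V : ℤ^d → [−λ, Λ]` (`d ≥ 3`, every mesh), ANY
# bounded block columns `Ψ` and ANY cube limit `M = T_∞⁻¹`: `C_∞ = G − H_resp∘Q′∘G ∈ L(ℓ^∞(ℤ^d))` with `‖C_∞‖ ≤ C(d, a, λ, Λ)` — `G = H_V⁻¹`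
# ((188)), `Q′` the block means (`‖Q′‖ ≤ 1`), `H_resp m = Σ′_{b″}m(b″)h_{b″}` the response superposition ((200)'s kernels decay at the block
# scale, so `‖H_resp‖ ≤ C_rK_{δ_r}`) — whose values are (211)'s fluctuation parts: `Q′(C_∞f) = 0` and `H_V(C_∞f) = f − (Σ′(Q′Gf)(b″)M(·,b″))∘blk`
# for every `f ∈ ℓ^∞(ℤ^d)`; the road's third next-scale object in the sup road's currency (row NE7b, node U5c; (188)∕(200)∕(211) BY NAME;
# [folklore])

Cell `pub-balaban`, sub-cell `t4`, spine estimate NE7b (`T4WeightBudget.RelWeightBound`; the cell's OWN estimate — NOT PRINTED in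
[Bałaban 1983–89], NOT PROVED).  Crux-route work under `Spine/NE7b/` by the row OWNER (`t4-ne7b-p1` gen 124, file (212)) under FREEZE
(0)'s crux-prover clause; NOTHING of Bałaban's is named as a Lean object, valued or asserted; no `T4Continuum/Support` leaf typed; no `def`,
no notation (the operators are `∃` of Mathlib's `→L[ℝ]` on `lp (fun _ : X d => ℝ) ∞`, their actions DISPLAYED); zero `sorry`.  Imports (BY
NAME): the OWNER's (211) `…SupZdCovarianceBounded` (`zd_fluctuation_bounded`; through it (200) `zd_response_kernel`, (189) `summable_exp_l1`,
`tsum_exp_l1_le`), (203) `…SupZdCoarseInverseOperator` (the `lp∞` kit; (188) `exists_zd_propagator_clm`, (48) `abs_apply_le_norm`), Mathlib's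
`memℓp_infty`, `lp.norm_le_of_forall_le`, `LinearMap.mkContinuous`, `ContinuousLinearMap.opNorm_comp_le`, `norm_sub_le`.

WHY (located).  (188) put `H_V⁻¹` and (203) put `T_∞`, `M` into `L(ℓ^∞(ℤ^d))`; the covariance `C = H⁻¹ − H⁻¹Q′*(Q′H⁻¹Q′*)⁻¹Q′H⁻¹` is the
composite `G − H_resp∘Q′∘G` once the response superposition `m ↦ Σ′_{b″}m(b″)h_{b″}` is a bounded operator from the coarse to the fine
`ℓ^∞` — which it is, the kernels `h_{b″}(p)` being dominated by `C_re^{−δ_r|blk n p − b″|₁}` ((200)) with row sums `≤ C_rK_{δ_r}` ((189)).  The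
identities are (211)'s, read on `u = Gf`.

WHAT IS PROVED ([folklore]; `ℓ^∞ = lp (fun _ : X d => ℝ) ∞`): §1 **`blockMean_clm`** (`∃ Q′ ∈ L(ℓ^∞)`, `‖Q′‖ ≤ 1`, displayed action),
**`blk_kernel_clm`** (`|K(p,b″)| ≤ Ce^{−δ|blk n p − b″|₁}` ⟹ `∃ Kop ∈ L(ℓ^∞)`, `(Kop m)(p) = Σ′_{b″}m(b″)K(p,b″)`, `‖Kop‖ ≤ CK_δ`); §2
**`zd_covariance_clm`** (THE END: `∃ C > 0`: for ALL `n, V, Ψ`, ANY cube limit `M`: `∃ G Cop ∈ L(ℓ^∞)`, `H_V(Gf) = f`, `‖Cop‖ ≤ C`,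
`(Cop f)(p) = (Gf)(p) − Σ′_{b″}(Q′Gf)(b″)h_{b″}(p)`, `Q′(Cop f) = 0`, `H_V(Cop f) = f − (Σ′_{b″}(Q′Gf)(b″)M(·,b″))∘blk`); §3 toy.

HONEST (what this is NOT).  `ℓ^∞` packaging only (no `ℓ²` self-adjointness ∕ positivity of `C_∞` typed, no decay of its kernel beyond
(201)); the LINEAR column only; `d ≥ 3` only; scalar skeleton ((A3), NC-NE7b-α UNRULED); nothing of the covariant propagators of [B4]–[B6];
nothing of Bałaban's asserted.  BY-NAME EFFECT ON THE WALL: NONE.  NE7b NOT PRINTED ∕ NOT PROVED; spine PROVED 0∕9; rung (B)+1 — the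
programme's measures remain FINITE-torus statements; NOT the mass gap, NOT Clay.  HONEST DEPENDENCY: continuum YM on T⁴ ⇐ BetaPertH ∧
nine spine estimates (0∕9 proved); BetaPertH ⇐ (D1) ∧ (D4) ∧ CAP+tail; G-an2-4 gates asym, D1 and NE2∕3∕4.
-/

set_option autoImplicit false

noncomputable section

namespace Summit.QuantumFields.BalabanUV.T4Continuum.NE7b.SupZdCovarianceOperator

open Real Filter Topology
open scoped ENNReal
open Literature.MathematicalPhysics.QuantumFieldTheory.Balaban1983to89
open B6QGQLower276 (X e blk B side chart mem_B sum_B sum_B_const card_cube blk_chart)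
open SupZdExponentialSums (summable_exp_l1 tsum_exp_l1_le)
open SupZdPropagatorOperator (exists_zd_propagator_clm)
open SupZdResponseKernel (zd_response_kernel)
open SupZdCovarianceBounded (zd_fluctuation_bounded)
open OneShotChartSupOperator (abs_apply_le_norm)

variable {d : ℕ}

/-! ## §1. Block means and block-scale decaying kernels as bounded operators on `ℓ^∞(ℤ^d)` -/

/-- **THE BLOCK-MEAN OPERATOR `Q′ ∈ L(ℓ^∞(ℤ^d))`**: `(Q′u)(b) = (n+1)^{−d}Σ_{q ∈ B n b}u(q)`, `‖Q′‖ ≤ 1`. [folklore] -/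
theorem blockMean_clm (n : ℕ) :
    ∃ Qop : lp (fun _ : X d => ℝ) ∞ →L[ℝ] lp (fun _ : X d => ℝ) ∞,
      ‖Qop‖ ≤ 1 ∧ ∀ (u : lp (fun _ : X d => ℝ) ∞) (b : X d), Qop u b = (((n : ℝ) + 1) ^ d)⁻¹ * ∑ q ∈ B n b, u q := by
  classical
  have hvol : (0 : ℝ) < ((n : ℝ) + 1) ^ d := by positivity
  have hbd : ∀ (u : lp (fun _ : X d => ℝ) ∞) (b : X d), |(((n : ℝ) + 1) ^ d)⁻¹ * ∑ q ∈ B n b, u q| ≤ 1 * ‖u‖ := by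
    intro u b
    rw [abs_mul, abs_inv, abs_of_pos hvol, inv_mul_le_iff₀ hvol, one_mul]
    calc |∑ q ∈ B n b, u q| ≤ ∑ q ∈ B n b, |u q| := Finset.abs_sum_le_sum_abs _ _
      _ ≤ ∑ _q ∈ B n b, ‖u‖ := Finset.sum_le_sum fun q _ => abs_apply_le_norm u q
      _ = _ := sum_B_const _ _
  have hmem : ∀ u : lp (fun _ : X d => ℝ) ∞, Memℓp (fun b : X d => (((n : ℝ) + 1) ^ d)⁻¹ * ∑ q ∈ B n b, u q) ∞ := fun u =>
    memℓp_infty ⟨1 * ‖u‖, by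
      rintro _ ⟨b, rfl⟩
      show ‖(((n : ℝ) + 1) ^ d)⁻¹ * ∑ q ∈ B n b, u q‖ ≤ _
      rw [Real.norm_eq_abs]; exact hbd u b⟩
  let Q₀ : lp (fun _ : X d => ℝ) ∞ → lp (fun _ : X d => ℝ) ∞ := fun u => ⟨fun b => (((n : ℝ) + 1) ^ d)⁻¹ * ∑ q ∈ B n b, u q, hmem u⟩
  have hQ₀ : ∀ (u : lp (fun _ : X d => ℝ) ∞) (b : X d), Q₀ u b = (((n : ℝ) + 1) ^ d)⁻¹ * ∑ q ∈ B n b, u q := fun _ _ => rfl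
  let Ql : lp (fun _ : X d => ℝ) ∞ →ₗ[ℝ] lp (fun _ : X d => ℝ) ∞ :=
    { toFun := Q₀
      map_add' := fun f g => lp.ext (funext fun b => by
        rw [lp.coeFn_add, Pi.add_apply, hQ₀, hQ₀, hQ₀, ← mul_add, ← Finset.sum_add_distrib]
        exact congrArg _ (Finset.sum_congr rfl fun q _ => by rw [lp.coeFn_add, Pi.add_apply]))
      map_smul' := fun c f => lp.ext (funext fun b => by
        rw [lp.coeFn_smul, Pi.smul_apply, RingHom.id_apply, hQ₀, hQ₀, smul_eq_mul, Finset.mul_sum, Finset.mul_sum, Finset.mul_sum]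
        exact Finset.sum_congr rfl fun q _ => by rw [lp.coeFn_smul, Pi.smul_apply, smul_eq_mul]; ring) }
  have hb : ∀ u, ‖Ql u‖ ≤ 1 * ‖u‖ := fun u =>
    lp.norm_le_of_forall_le (by positivity) fun b => by rw [Real.norm_eq_abs]; exact hbd u b
  exact ⟨Ql.mkContinuous 1 hb, Ql.mkContinuous_norm_le zero_le_one hb, fun u b => rfl⟩

/-- **BLOCK-SCALE DECAYING KERNELS ACT FROM THE COARSE TO THE FINE `ℓ^∞`**: `|K(p,b″)| ≤ C·e^{−δ|blk n p − b″|₁}` ⟹ `∃ Kop ∈ L(ℓ^∞(ℤ^d))` with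
`(Kop m)(p) = Σ′_{b″}m(b″)K(p,b″)` and `‖Kop‖ ≤ C·K_δ`. [folklore] -/
theorem blk_kernel_clm (n : ℕ) {C δ : ℝ} (hC : 0 ≤ C) (hδ : 0 < δ) (K : X d → X d → ℝ)
    (hK : ∀ p b'', |K p b''| ≤ C * exp (-(δ * ∑ i, (((blk n p i - b'' i).natAbs : ℕ) : ℝ)))) :
    ∃ Kop : lp (fun _ : X d => ℝ) ∞ →L[ℝ] lp (fun _ : X d => ℝ) ∞,
      ‖Kop‖ ≤ C * (2 * (1 - exp (-δ))⁻¹) ^ d ∧ ∀ (m : lp (fun _ : X d => ℝ) ∞) (p : X d), Kop m p = ∑' b'' : X d, m b'' * K p b'' := by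
  classical
  set Kδ : ℝ := (2 * (1 - exp (-δ))⁻¹) ^ d with hKδ
  have hKδ0 : 0 ≤ Kδ := pow_nonneg (mul_nonneg zero_le_two (inv_nonneg.2 (sub_nonneg.2 (exp_le_one_iff.2 (by linarith))))) d
  have hdom : ∀ (m : lp (fun _ : X d => ℝ) ∞) (p b'' : X d),
      |m b'' * K p b''| ≤ ‖m‖ * C * exp (-(δ * ∑ i, (((blk n p i - b'' i).natAbs : ℕ) : ℝ))) := fun m p b'' => by
    rw [abs_mul]
    calc |m b''| * |K p b''| ≤ ‖m‖ * (C * exp (-(δ * ∑ i, (((blk n p i - b'' i).natAbs : ℕ) : ℝ)))) :=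
          mul_le_mul (abs_apply_le_norm m b'') (hK p b'') (abs_nonneg _) (norm_nonneg _)
      _ = _ := by ring
  have hs : ∀ (m : lp (fun _ : X d => ℝ) ∞) (p : X d), Summable fun b'' : X d => m b'' * K p b'' := fun m p =>
    Summable.of_norm_bounded ((summable_exp_l1 hδ (blk n p)).mul_left (‖m‖ * C)) fun b'' => by
      rw [Real.norm_eq_abs]; exact hdom m p b''
  have hbd : ∀ (m : lp (fun _ : X d => ℝ) ∞) (p : X d), |∑' b'' : X d, m b'' * K p b''| ≤ C * Kδ * ‖m‖ := by
    intro m p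
    have h1 : |∑' b'' : X d, m b'' * K p b''| ≤ ∑' b'' : X d, |m b'' * K p b''| := by
      have := norm_tsum_le_tsum_norm (hs m p).norm; simpa only [Real.norm_eq_abs] using this
    have h2 := (hs m p).abs.tsum_le_tsum (hdom m p) ((summable_exp_l1 hδ (blk n p)).mul_left (‖m‖ * C))
    rw [(summable_exp_l1 hδ (blk n p)).tsum_mul_left] at h2
    have h3 := mul_le_mul_of_nonneg_left (tsum_exp_l1_le hδ (blk n p)) (show 0 ≤ ‖m‖ * C by positivity)
    rw [← hKδ] at h3
    calc |∑' b'' : X d, m b'' * K p b''| ≤ ‖m‖ * C * Kδ := h1.trans (h2.trans h3)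
      _ = C * Kδ * ‖m‖ := by ring
  have hmem : ∀ m : lp (fun _ : X d => ℝ) ∞, Memℓp (fun p : X d => ∑' b'' : X d, m b'' * K p b'') ∞ := fun m =>
    memℓp_infty ⟨C * Kδ * ‖m‖, by
      rintro _ ⟨p, rfl⟩
      show ‖∑' b'' : X d, m b'' * K p b''‖ ≤ _
      rw [Real.norm_eq_abs]; exact hbd m p⟩
  let K₀ : lp (fun _ : X d => ℝ) ∞ → lp (fun _ : X d => ℝ) ∞ := fun m => ⟨fun p => ∑' b'' : X d, m b'' * K p b'', hmem m⟩
  have hK₀ : ∀ (m : lp (fun _ : X d => ℝ) ∞) (p : X d), K₀ m p = ∑' b'' : X d, m b'' * K p b'' := fun _ _ => rfl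
  let Kl : lp (fun _ : X d => ℝ) ∞ →ₗ[ℝ] lp (fun _ : X d => ℝ) ∞ :=
    { toFun := K₀
      map_add' := fun f g => lp.ext (funext fun p => by
        rw [lp.coeFn_add, Pi.add_apply, hK₀, hK₀, hK₀, ← Summable.tsum_add (hs f p) (hs g p)]
        exact tsum_congr fun b'' => by rw [lp.coeFn_add, Pi.add_apply, add_mul])
      map_smul' := fun c f => lp.ext (funext fun p => by
        rw [lp.coeFn_smul, Pi.smul_apply, RingHom.id_apply, hK₀, hK₀, smul_eq_mul, ← tsum_mul_left]
        exact tsum_congr fun b'' => by rw [lp.coeFn_smul, Pi.smul_apply, smul_eq_mul]; ring) }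
  have hb : ∀ m, ‖Kl m‖ ≤ C * Kδ * ‖m‖ := fun m =>
    lp.norm_le_of_forall_le (by positivity) fun p => by rw [Real.norm_eq_abs]; exact hbd m p
  exact ⟨Kl.mkContinuous _ hb, Kl.mkContinuous_norm_le (by positivity) hb, fun m p => rfl⟩

/-! ## §2. THE END: the fluctuation covariance as a bounded operator on `ℓ^∞(ℤ^d)` -/

/-- **HEADLINE — `C_∞ ∈ L(ℓ^∞(ℤ^d))`**: `d ≥ 3`, `a > 0`, `λ < min(2,a)`, `Λ ≥ 0` ⟹ `∃ C > 0` (from `(d, a, λ, Λ)` ONLY) such that for ALL `n`,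
`V : ℤ^d → [−λ, Λ]`, ANY bounded block columns `Ψ` and ANY cube limit `M`: there is `Cop : ℓ^∞ →L[ℝ] ℓ^∞` with `‖Cop‖ ≤ C` whose action is
(211)'s display `Cop f = Gf − Σ′_{b″}(Q′(Gf))(b″)·h_{b″}` (`G = H_V⁻¹` of (188), `h_{b″} = Σ′_{b′}M(b′,b″)Ψ_{b′}` of (200)), and hence ((211))
`Q′(Cop f) = 0` and `H_V(Cop f) = f − (Σ′_{b″}(Q′Gf)(b″)M(·,b″))∘blk` for every `f ∈ ℓ^∞` — `Cop = G − H_resp∘Q′∘G` with §1's operators.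
[folklore] -/
theorem zd_covariance_clm (hd : 3 ≤ d) (a : ℝ) (ha : 0 < a) {lam Lam : ℝ} (hlam : lam < min 2 a) (hLam : 0 ≤ Lam) :
    ∃ C : ℝ, 0 < C ∧ ∀ (n : ℕ) (V : X d → ℝ), (∀ p, -lam ≤ V p) → (∀ p, V p ≤ Lam) →
      ∀ (Ψ : X d → X d → ℝ) (BΨ : X d → ℝ), (∀ b' p, |Ψ b' p| ≤ BΨ b') →
      (∀ b' p, ((n : ℝ) + 1) ^ 2 * ∑ μ, (2 * Ψ b' p - Ψ b' (p + e μ) - Ψ b' (p - e μ))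
        + a / ((n : ℝ) + 1) ^ d * ∑ q ∈ B n (blk n p), Ψ b' q + V p * Ψ b' p = if blk n p = b' then 1 else 0) →
      ∀ (M : X d → X d → ℝ), (∀ b b' : X d, Tendsto (fun R : ℕ =>
          if h : b ∈ (Fintype.piFinset fun _ : Fin d => Finset.Icc (-(R : ℤ)) R) ∧
              b' ∈ (Fintype.piFinset fun _ : Fin d => Finset.Icc (-(R : ℤ)) R)
            then (Matrix.of fun c c' : ↥(Fintype.piFinset fun _ : Fin d => Finset.Icc (-(R : ℤ)) R) =>
              (((n : ℝ) + 1) ^ d)⁻¹ * ∑ q ∈ B n (c : X d), Ψ (c' : X d) q)⁻¹ ⟨b, h.1⟩ ⟨b', h.2⟩ else 0)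
        atTop (𝓝 (M b b'))) →
      ∃ G Cop : lp (fun _ : X d => ℝ) ∞ →L[ℝ] lp (fun _ : X d => ℝ) ∞,
        ‖Cop‖ ≤ C ∧
        (∀ (f : lp (fun _ : X d => ℝ) ∞) (p : X d),
          ((n : ℝ) + 1) ^ 2 * ∑ μ, (2 * G f p - G f (p + e μ) - G f (p - e μ))
            + a / ((n : ℝ) + 1) ^ d * ∑ q ∈ B n (blk n p), G f q + V p * G f p = f p) ∧
        (∀ (f : lp (fun _ : X d => ℝ) ∞) (p : X d), Cop f p
          = G f p - ∑' b'' : X d, ((((n : ℝ) + 1) ^ d)⁻¹ * ∑ q ∈ B n b'', G f q) * ∑' b' : X d, M b' b'' * Ψ b' p) ∧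
        (∀ (f : lp (fun _ : X d => ℝ) ∞) (b : X d), (((n : ℝ) + 1) ^ d)⁻¹ * ∑ q ∈ B n b, Cop f q = 0) ∧
        (∀ (f : lp (fun _ : X d => ℝ) ∞) (p : X d),
          ((n : ℝ) + 1) ^ 2 * ∑ μ, (2 * Cop f p - Cop f (p + e μ) - Cop f (p - e μ))
            + a / ((n : ℝ) + 1) ^ d * ∑ q ∈ B n (blk n p), Cop f q + V p * Cop f p
          = f p - ∑' b'' : X d, ((((n : ℝ) + 1) ^ d)⁻¹ * ∑ q ∈ B n b'', G f q) * M (blk n p) b'') := by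
  classical
  obtain ⟨CG, hCG, H188⟩ := exists_zd_propagator_clm (d := d) hd a ha hlam hLam
  obtain ⟨Cr, δr, hCr, hδr, H200⟩ := zd_response_kernel (d := d) hd a ha hlam hLam
  obtain ⟨Cf, hCf, H211⟩ := zd_fluctuation_bounded (d := d) hd a ha hlam hLam
  have hKr : 0 ≤ (2 * (1 - exp (-δr))⁻¹) ^ d := pow_nonneg (mul_nonneg zero_le_two (inv_nonneg.2 (sub_nonneg.2 (exp_le_one_iff.2 (by linarith))))) d
  refine ⟨CG + Cr * (2 * (1 - exp (-δr))⁻¹) ^ d * 1 * CG, by positivity, ?_⟩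
  intro n V hV hV' Ψ BΨ hΨB hΨ M hM
  obtain ⟨G, hGnorm, hGeq, hGuniq⟩ := H188 n V hV hV'
  have hresp := H200 n V hV hV' Ψ BΨ hΨB hΨ M hM
  obtain ⟨Qop, hQnorm, hQ⟩ := blockMean_clm (d := d) n
  obtain ⟨Rop, hRnorm, hR⟩ := blk_kernel_clm (d := d) n hCr.le hδr (fun p b'' => ∑' b' : X d, M b' b'' * Ψ b' p)
    (fun p b'' => (hresp b'').2.1 p)
  refine ⟨G, G - Rop.comp (Qop.comp G), ?_, hGeq, fun f p => ?_, fun f b => ?_, fun f p => ?_⟩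
  · -- the norm
    calc ‖G - Rop.comp (Qop.comp G)‖ ≤ ‖G‖ + ‖Rop.comp (Qop.comp G)‖ := norm_sub_le _ _
      _ ≤ ‖G‖ + ‖Rop‖ * (‖Qop‖ * ‖G‖) :=
          add_le_add le_rfl ((ContinuousLinearMap.opNorm_comp_le _ _).trans
            (mul_le_mul_of_nonneg_left (ContinuousLinearMap.opNorm_comp_le _ _) (norm_nonneg _)))
      _ ≤ CG + Cr * (2 * (1 - exp (-δr))⁻¹) ^ d * (1 * CG) := by
          gcongr
      _ = _ := by ring
  · -- the display
    rw [show (G - Rop.comp (Qop.comp G)) f = G f - Rop (Qop (G f)) from rfl, lp.coeFn_sub, Pi.sub_apply, hR]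
    exact congrArg _ (tsum_congr fun b'' => by rw [hQ])
  · -- zero block means ((211) (ii) with `u = Gf`)
    have h := (H211 n V hV hV' Ψ BΨ hΨB hΨ M hM ‖f‖ (fun q => f q) (fun q => abs_apply_le_norm f q) (fun q => G f q) ‖G f‖
      (fun q => abs_apply_le_norm (G f) q) (hGeq f)).2.2.2.1 b
    rw [← h]
    refine congrArg _ (Finset.sum_congr rfl fun q _ => ?_)
    rw [show (G - Rop.comp (Qop.comp G)) f = G f - Rop (Qop (G f)) from rfl, lp.coeFn_sub, Pi.sub_apply, hR]
    exact congrArg _ (tsum_congr fun b'' => by rw [hQ])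
  · -- the equation ((211) (iii) with `u = Gf`)
    have h := (H211 n V hV hV' Ψ BΨ hΨB hΨ M hM ‖f‖ (fun q => f q) (fun q => abs_apply_le_norm f q) (fun q => G f q) ‖G f‖
      (fun q => abs_apply_le_norm (G f) q) (hGeq f)).2.2.2.2 p
    have hCf : ∀ q : X d, (G - Rop.comp (Qop.comp G)) f q
        = G f q - ∑' b'' : X d, ((((n : ℝ) + 1) ^ d)⁻¹ * ∑ q' ∈ B n b'', G f q') * ∑' b' : X d, M b' b'' * Ψ b' q := by
      intro q
      rw [show (G - Rop.comp (Qop.comp G)) f = G f - Rop (Qop (G f)) from rfl, lp.coeFn_sub, Pi.sub_apply, hR]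
      exact congrArg _ (tsum_congr fun b'' => by rw [hQ])
    simp only [hCf]
    exact h

/-! ## §3. Toy -/

/-- Toy (`d = 2`, `n = 0`): the block-mean operator on mesh `0` exists with norm `≤ 1`. -/
example : ∃ Qop : lp (fun _ : X 2 => ℝ) ∞ →L[ℝ] lp (fun _ : X 2 => ℝ) ∞,
    ‖Qop‖ ≤ 1 ∧ ∀ (u : lp (fun _ : X 2 => ℝ) ∞) (b : X 2), Qop u b = ((((0 : ℕ) : ℝ) + 1) ^ 2)⁻¹ * ∑ q ∈ B 0 b, u q :=
  blockMean_clm (d := 2) 0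

end Summit.QuantumFields.BalabanUV.T4Continuum.NE7b.SupZdCovarianceOperator
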